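import Mathlib
import Summits.Ventures.PercRepro2.Defs
import Summits.Ventures.PercRepro2.Graph
import Summits.Ventures.PercRepro2.OneColourSwitch
import Summits.Ventures.PercRepro2.RegionHubSign
import Summits.Ventures.PercRepro2.SideSwitch
import Summits.Ventures.PercRepro2.SideSwitchComps
import Summits.Ventures.PercRepro2.SideSwitchM9
import Summits.Ventures.PercRepro2.TermSwitchDefs
import Summits.Ventures.PercRepro2.TermSwitchFibre
import Summits.Ventures.PercRepro2.TermSwitchCompsFibre
import Summits.Ventures.PercRepro2.TermSwitchMono
import Summits.Ventures.PercRepro2.TermSwitchM9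
import Summits.Ventures.PercRepro2.TermSwitchRestrict
import Summits.Ventures.PercRepro2.M9NoPocketDefs
import Summits.Ventures.PercRepro2.M9Unreached
import Summits.Ventures.PercRepro2.M9YSliceDefs

/-!
# The reached half of the `Y`-slice is non-positive (blind cell PercRepro2, p3 g26, 2026-08-28;
`proofs/P3-YSLICE.md` §3(K))

`ySliceK ≤ 0` (`ySliceK_nonpos`, no `r–s` edges): in the `{r, s}`-fibration of the lane a
slice point with `d` reached has `d` in a `Y`-side component `C_d` of a representative whose
`d`-edges are all `Y` (`starY_mem_KH_assignC_iff`: the slice predicate along a fibre is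
«`d` is sided, the representative is in the slice, and `C_d ∉ T`»), and the outside flip
preserves the slice (`starY_flipOH_iff`); so the slice meets the fibre exactly in the HALF
`{C_d ∉ T}`, whose paired-kernel sum is `≤ 0` by `sum_pairKer_half_nonpos` of `M9YSliceDefs`.
Own work; std axioms.
-/

namespace Summit.Ventures.PercRepro2

namespace NoPocket

open Finset Classical RegionHub OneColourSwitch SideSwitch TermSwitch

variable {V : Type*} {E : Type*}
variable [Fintype V] [DecidableEq V] [Fintype E] [DecidableEq E]

section K

variable {ends : E → Sym2 V}

omit [Fintype V] [DecidableEq V] [Fintype E] [DecidableEq E] in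
/-- An edge at `d` touching a set not containing `d` joins `d` to a vertex of the set. -/
lemma exists_of_mem_touches_of_mem {S : Set V} {d : V} (hd : d ∉ S) {e : E} (hde : d ∈ ends e)
    (he : e ∈ touches ends S) : ∃ x ∈ S, ends e = s(d, x) := by
  obtain ⟨x, hx, y, hxy⟩ := he
  rw [hxy, Sym2.mem_iff] at hde
  rcases hde with rfl | rfl
  · exact (hd hx).elim
  · exact ⟨x, hx, by rw [hxy, Sym2.eq_swap]⟩

omit [DecidableEq V] [Fintype E] [DecidableEq E] in
/-- Two sided vertices joined by an edge lie in the same component. -/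
lemma mem_compIn_of_edge {S : Set V} {x y : V} (hx : x ∈ S) (hy : y ∈ S) {e : E}
    (hxy : ends e = s(x, y)) : y ∈ compIn ends S x := by
  rw [mem_compIn]
  refine conn_of_openAdj ⟨e, ?_, hxy⟩
  rw [chi_eq_true_iff]
  exact ⟨x, hx, y, hy, hxy⟩

omit [Fintype E] [DecidableEq E] in
/-- The `d`-edges of a representative are untouched by an assignment not containing the
component of `d`. -/
lemma assignC_eq_at_d {H : Set V} {ρ : Config E} {d : V} (hd : d ∈ A0H ends H ρ)
    {T : Finset (Finset V)} (hT : T ⊆ compsH ends H ρ)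
    (hdT : compIn ends (↑(A0H ends H ρ) : Set V) d ∉ T) {e : E} (hde : d ∈ ends e) :
    assignC ends T ρ e = ρ e := by
  simp only [assignC, assign]
  refine flipTouch_of_notMem ends ?_
  intro he
  have hdU : d ∉ unionT T := by
    intro h
    obtain ⟨C, hC, hdC⟩ := mem_unionT.1 h
    rw [eq_compIn_of_mem_compsH (hT hC) hdC] at hC
    exact hdT hC
  obtain ⟨x, hx, hex⟩ := exists_of_mem_touches_of_mem (S := (↑(unionT T) : Set V))
    (fun h => hdU (Finset.mem_coe.1 h)) hde he
  have hxU : x ∈ unionT T := Finset.mem_coe.1 hx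
  obtain ⟨C, hC, hxC⟩ := mem_unionT.1 hxU
  have hxA : x ∈ A0H ends H ρ := unionT_subset_A0H hT hxU
  have hdC : d ∈ compIn ends (↑(A0H ends H ρ) : Set V) x :=
    mem_compIn_of_edge (Finset.mem_coe.2 hxA) (Finset.mem_coe.2 hd) (by rw [hex, Sym2.eq_swap])
  have hC' : C = compIn ends (↑(A0H ends H ρ) : Set V) x := eq_compIn_of_mem_compsH (hT hC) hxC
  apply hdT
  rw [compIn_eq_of_mem hdC, ← hC']
  exact hC

/-- The slice predicate along a fibre: at the assignment `T` of a representative it is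
«the representative is in the slice, `d` is sided and its component is not in `T`». -/
lemma starY_mem_KH_assignC_iff {p q : V} {H : Set V} {ρ : Config E}
    (hρ : ρ ∈ RepH ends p q H) {d : V} (hdH : d ∉ H)
    {T : Finset (Finset V)} (hT : T ⊆ compsH ends H ρ) :
    (StarY ends d (assignC ends T ρ) ∧ d ∈ KH ends H (assignC ends T ρ)) ↔
      (StarY ends d ρ ∧ d ∈ A0H ends H ρ ∧
        compIn ends (↑(A0H ends H ρ) : Set V) d ∉ T) := by
  rcases vertex_cases_H (ends := ends) (H := H) ρ d with hdH' | hdA | hdO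
  · exact (hdH hdH').elim
  · by_cases hdT : compIn ends (↑(A0H ends H ρ) : Set V) d ∈ T
    · have hdU : d ∈ unionT T := mem_unionT.2 ⟨_, hdT, mem_compIn_self _ _⟩
      have := (sideC_of_mem_H hρ hT hdU).1
      constructor
      · rintro ⟨_, h⟩; exact (this h).elim
      · rintro ⟨_, _, h⟩; exact (h hdT).elim
    · have hdU : d ∉ unionT T := by
        intro h
        obtain ⟨C, hC, hdC⟩ := mem_unionT.1 h
        rw [eq_compIn_of_mem_compsH (hT hC) hdC] at hC
        exact hdT hC
      have hK : d ∈ KH ends H (assignC ends T ρ) := by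
        have hd' : d ∈ unionT (compsH ends H ρ) \ unionT T := by
          rw [unionT_compsH]
          exact Finset.mem_sdiff.2 ⟨hdA, hdU⟩
        exact (sideC_of_mem_sdiff_H hρ hT (Finset.Subset.refl _) hd').1
      have hS : StarY ends d (assignC ends T ρ) ↔ StarY ends d ρ := by
        unfold StarY
        constructor
        · intro h e hde hnd
          rw [← assignC_eq_at_d hdA hT hdT hde]
          exact h e hde hnd
        · intro h e hde hnd
          rw [assignC_eq_at_d hdA hT hdT hde]
          exact h e hde hnd
      rw [hS]
      exact ⟨fun h => ⟨h.1, hdA, hdT⟩, fun h => ⟨h.1, hK⟩⟩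
  · have hdO' : d ∈ OsetH ends H (assignC ends T ρ) := by rw [OsetH_assignC hT]; exact hdO
    have hnK : d ∉ KH ends H (assignC ends T ρ) := fun h => hdO' (Or.inl h)
    have hnA : d ∉ A0H ends H ρ := fun h => hdO (Or.inl (A0H_subset_KH_of_mem_RepH hρ h))
    constructor
    · rintro ⟨_, h⟩; exact (hnK h).elim
    · rintro ⟨_, h, _⟩; exact (hnA h).elim

omit [DecidableEq V] [Fintype E] [DecidableEq E] in
/-- The slice predicate of a representative is preserved by the outside flip when `d` is
sided. -/
lemma starY_flipOH_iff {H : Set V} {ρ : Config E} {d : V} (hd : d ∈ A0H ends H ρ) :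
    StarY ends d (flipOH ends H ρ) ↔ StarY ends d ρ := by
  have hdO : d ∉ OsetH ends H ρ := by
    intro h
    obtain ⟨hU, _⟩ := mem_A0H.1 hd
    exact h hU
  have hnot : ∀ e, d ∈ ends e → e ∉ within ends (OsetH ends H ρ) := by
    intro e hde ⟨x, hx, y, hy, hxy⟩
    rw [hxy, Sym2.mem_iff] at hde
    rcases hde with rfl | rfl
    · exact hdO hx
    · exact hdO hy
  unfold StarY
  constructor
  · intro h e hde hnd
    have := h e hde hnd
    rwa [flipOH, flipIn_of_notMem (hnot e hde)] at this
  · intro h e hde hnd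
    rw [flipOH, flipIn_of_notMem (hnot e hde)]
    exact h e hde hnd

/-- **The reached half of the `Y`-slice is non-positive** (no `r–s` edges): every non-mark `d`
has `Σ_{Sep ∧ DOne(d), every edge at d is Y, d ∈ K₂} σ_pq · σ_rs ≤ 0`. -/
theorem ySliceK_nonpos {p q r s d : V} (hr : d ≠ r) (hs : d ≠ s)
    (hrs : ∀ e, ends e ≠ s(r, s)) : ySliceK ends p q r s d ≤ 0 := by
  have hdH : d ∉ ({r, s} : Set V) := by
    simp only [Set.mem_insert_iff, Set.mem_singleton_iff, not_or]
    exact ⟨hr, hs⟩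
  have hrH : r ∈ ({r, s} : Set V) := Set.mem_insert r _
  -- the slice sum as a sum over the `DZero` colourings of the terminal set
  have h1 : ySliceK ends p q r s d = ∑ ω ∈ DZeroSetH ends p q ({r, s} : Set V),
      if StarY ends d ω ∧ d ∈ KH ends ({r, s} : Set V) ω then sigma ends ω p q * sigma ends ω r s else 0 := by
    have hset : DZeroSetH ends p q ({r, s} : Set V) =
        univ.filter (fun ω => sepH ends p q ({r, s} : Set V) ω ∧ DZeroH ends ({r, s} : Set V) ω) := by
      ext ω; simp [DZeroSetH, SepSetH]
    rw [hset, Finset.sum_filter, ySliceK]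
    refine Finset.sum_congr rfl (fun ω _ => ?_)
    by_cases hc : sep2 ends p q r s ω ∧ DOne ends r s d ω ∧ StarY ends d ω
    · have hc' := (slice_iff_pair hr hs).1 hc
      by_cases hK : d ∈ K2 ends r s ω
      · rw [if_pos ⟨hc.1, hc.2.1, hc.2.2, hK⟩, if_pos hc'.1, if_pos ⟨hc'.2, hK⟩]
      · rw [if_neg (fun h => hK h.2.2.2), if_pos hc'.1, if_neg (fun h => hK h.2)]
    · have hc' : ¬ ((sepH ends p q ({r, s} : Set V) ω ∧ DZeroH ends ({r, s} : Set V) ω) ∧ StarY ends d ω) :=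
        fun h => hc ((slice_iff_pair hr hs).2 h)
      rw [if_neg (fun h => hc ⟨h.1, h.2.1, h.2.2.1⟩)]
      by_cases hsep : sepH ends p q ({r, s} : Set V) ω ∧ DZeroH ends ({r, s} : Set V) ω
      · rw [if_pos hsep, if_neg (fun h => hc' ⟨hsep, h.1⟩)]
      · rw [if_neg hsep]
  -- the fibration
  rw [h1, sum_dzeroH_eq_sum_repH_comps (fun ω =>
    if StarY ends d ω ∧ d ∈ KH ends ({r, s} : Set V) ω then sigma ends ω p q * sigma ends ω r s else 0)]
  -- the slice predicate along the fibres
  have h2 : ∀ ρ ∈ RepH ends p q ({r, s} : Set V), (∑ T ∈ (compsH ends ({r, s} : Set V) ρ).powerset,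
      if StarY ends d (assignC ends T ρ) ∧ d ∈ KH ends ({r, s} : Set V) (assignC ends T ρ) then
        sigma ends (assignC ends T ρ) p q * sigma ends (assignC ends T ρ) r s else 0) =
      if StarY ends d ρ ∧ d ∈ A0H ends ({r, s} : Set V) ρ then
        ∑ T ∈ (compsH ends ({r, s} : Set V) ρ).powerset,
          (if compIn ends (↑(A0H ends ({r, s} : Set V) ρ) : Set V) d ∉ T then
            sigma ends (assignC ends T ρ) p q * sigma ends (assignC ends T ρ) r s else 0)
      else 0 := by
    intro ρ hρ
    by_cases hc : StarY ends d ρ ∧ d ∈ A0H ends ({r, s} : Set V) ρ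
    · rw [if_pos hc]
      refine Finset.sum_congr rfl (fun T hT => ?_)
      have hT := Finset.mem_powerset.1 hT
      rw [if_congr (starY_mem_KH_assignC_iff hρ hdH hT) rfl rfl]
      by_cases hdT : compIn ends (↑(A0H ends ({r, s} : Set V) ρ) : Set V) d ∉ T
      · rw [if_pos ⟨hc.1, hc.2, hdT⟩, if_pos hdT]
      · rw [if_neg (fun h => hdT h.2.2), if_neg hdT]
    · rw [if_neg hc]
      refine Finset.sum_eq_zero (fun T hT => ?_)
      have hT := Finset.mem_powerset.1 hT
      rw [if_congr (starY_mem_KH_assignC_iff hρ hdH hT) rfl rfl]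
      exact if_neg (fun h => hc ⟨h.1, h.2.1⟩)
  rw [Finset.sum_congr rfl h2]
  -- pairing with the outside flip
  set Φ : Config E → ℤ := fun ρ => if StarY ends d ρ ∧ d ∈ A0H ends ({r, s} : Set V) ρ then
      ∑ T ∈ (compsH ends ({r, s} : Set V) ρ).powerset,
        (if compIn ends (↑(A0H ends ({r, s} : Set V) ρ) : Set V) d ∉ T then
          sigma ends (assignC ends T ρ) p q * sigma ends (assignC ends T ρ) r s else 0)
      else 0 with hΦ
  set Φ' : Config E → ℤ := fun ρ => if StarY ends d ρ ∧ d ∈ A0H ends ({r, s} : Set V) ρ then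
      ∑ T ∈ (compsH ends ({r, s} : Set V) ρ).powerset,
        (if compIn ends (↑(A0H ends ({r, s} : Set V) ρ) : Set V) d ∉ T then
          sigma ends (assignC ends T (flipOH ends ({r, s} : Set V) ρ)) p q *
            sigma ends (assignC ends T ρ) r s else 0)
      else 0 with hΦ'
  have hO : ∑ ρ ∈ RepH ends p q ({r, s} : Set V), Φ ρ = ∑ ρ ∈ RepH ends p q ({r, s} : Set V), Φ' ρ := by
    symm
    refine Finset.sum_nbij' (fun ρ => flipOH ends ({r, s} : Set V) ρ) (fun ρ => flipOH ends ({r, s} : Set V) ρ)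
      (fun ρ hρ => flipOH_mem_RepH hρ) (fun ρ hρ => flipOH_mem_RepH hρ)
      (fun ρ _ => flipOH_flipOH ({r, s} : Set V) ρ) (fun ρ _ => flipOH_flipOH ({r, s} : Set V) ρ) ?_
    intro ρ hρ
    simp only [hΦ, hΦ']
    by_cases hc : StarY ends d ρ ∧ d ∈ A0H ends ({r, s} : Set V) ρ
    · have hc' : StarY ends d (flipOH ends ({r, s} : Set V) ρ) ∧ d ∈ A0H ends ({r, s} : Set V) (flipOH ends ({r, s} : Set V) ρ) := by
        rw [A0H_flipOH, starY_flipOH_iff hc.2]; exact hc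
      rw [if_pos hc, if_pos hc', compsH_flipOH, A0H_flipOH]
      refine Finset.sum_congr rfl (fun T hT => ?_)
      have hT := Finset.mem_powerset.1 hT
      rw [sigma_rs_assignC_flipOH hrH s hT]
    · have hc' : ¬ (StarY ends d (flipOH ends ({r, s} : Set V) ρ) ∧ d ∈ A0H ends ({r, s} : Set V) (flipOH ends ({r, s} : Set V) ρ)) := by
        rw [A0H_flipOH]
        rintro ⟨h1, h2⟩
        exact hc ⟨(starY_flipOH_iff h2).1 h1, h2⟩
      rw [if_neg hc, if_neg hc']
  have htwice : 2 * ∑ ρ ∈ RepH ends p q ({r, s} : Set V), Φ ρ ≤ 0 := by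
    have hsum : 2 * ∑ ρ ∈ RepH ends p q ({r, s} : Set V), Φ ρ = ∑ ρ ∈ RepH ends p q ({r, s} : Set V), (Φ ρ + Φ' ρ) := by
      rw [Finset.sum_add_distrib, ← hO]; ring
    rw [hsum]
    refine Finset.sum_nonpos (fun ρ hρ => ?_)
    simp only [hΦ, hΦ']
    by_cases hc : StarY ends d ρ ∧ d ∈ A0H ends ({r, s} : Set V) ρ
    · rw [if_pos hc, if_pos hc, ← Finset.sum_add_distrib]
      have hC₀ : compIn ends (↑(A0H ends ({r, s} : Set V) ρ) : Set V) d ∈ compsH ends ({r, s} : Set V) ρ :=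
        Finset.mem_image.2 ⟨d, hc.2, rfl⟩
      refine le_trans (le_of_eq ?_) (sum_pairKer_half_nonpos hρ hrs hC₀)
      refine Finset.sum_congr rfl (fun T _ => ?_)
      by_cases hdT : compIn ends (↑(A0H ends ({r, s} : Set V) ρ) : Set V) d ∉ T
      · rw [if_pos hdT, if_pos hdT, if_pos hdT]
        unfold pairKer
        ring
      · rw [if_neg hdT, if_neg hdT, if_neg hdT, add_zero]
    · rw [if_neg hc, if_neg hc, add_zero]
  linarith

end K

end NoPocket

end Summit.Ventures.PercRepro2
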